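import Literature.ModelTheory.ExponentialFields.DefinablyCompleteCalculus
import Mathlib.Topology.Order.Basic
import HarnessLib

/-!
# Definable families of subsets of `Kⁿ`: fibres, projections, closures

Topic `Literature/ModelTheory/ExponentialFields`.  Bookkeeping for the definable analysis in
`Kⁿ` of a definably complete ordered field `K` (Fornasiero–Servi, *Definably complete Baire
structures*, Fund. Math. 209 (2010), §1.2: definable families `(Y(y))_{y ∈ N}` of subsets of
`Kⁿ`, their closures and projections are definable — "most results of elementary real analysis
can be proved in every definably complete expansion of an ordered field"), in the format of
Mathlib's `Set.Definable` for subsets of `Fin n → K`: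

* a family `Y : K → Set (Fin n → K)` is coded by the set
  `{v : Fin (n + 1) → K | Fin.tail v ∈ Y (v 0)}` (index first, then the point);
* **`mem_closure_iff_forall_box`** — in the product of order topologies, `z ∈ closure S` iff
  every open box around `z` meets `S`;
* **`definable_family_closure`** — the family of closures of a definable family is definable;
* `definable_family_tail_image`, `definable_family_inter_le`, `definable_family_neg_index`,
  `definable_family_const`, `definable_fibre`, `definable_firstCoord_rel`, `definable₁_image_eval`
  — projections along the first coordinate, intersections with half-spaces `x₀ ≤ g(y)`, index
  reversal `y ↦ -y`, constant families, fibres, and the first-coordinate relation.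

These are the ingredients of the definable compactness of closed boxes in all dimensions
(`DefinablyCompactBoxes.lean`, Fornasiero–Servi 2010, Lemma 1.8).  Everything is proved; no
definitions.  Conventions (`hlt`, `hadd`: the graphs of `<`, `+` definable) as in
`DefinablyCompleteCalculus.lean`.

## References

* A. Fornasiero, T. Servi, *Definably complete Baire structures*, Fund. Math. 209 (2010),
  §1.2. [FornasieroServi2010]
* L. van den Dries, *Tame topology and o-minimal structures* (1998), Ch. 1, §2 (first-order
  closure properties of definable sets). [Dries1998]
-/

open Set FirstOrder FirstOrder.Language
open _root_.Filter _root_.Topology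

namespace Literature.ModelTheory.ExponentialFields

universe u v

/-! ### Closure in `Kⁿ` through open boxes -/

section Topology

variable {K : Type*} [LinearOrder K] [TopologicalSpace K] [OrderTopology K] [NoMinOrder K]
  [NoMaxOrder K]

/-- **Closure through boxes**: in `Kⁿ` with the product of the order topologies (`K` without
endpoints), `z ∈ closure S` iff every open box `Π (lᵢ, uᵢ) ∋ z` meets `S`. [folklore] -/
theorem mem_closure_iff_forall_box {n : ℕ} {S : Set (Fin n → K)} {z : Fin n → K} :
    z ∈ closure S ↔ ∀ l u : Fin n → K, (∀ i, l i < z i ∧ z i < u i) →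
      ∃ x ∈ S, ∀ i, l i < x i ∧ x i < u i := by
  rw [mem_closure_iff_nhds]
  constructor
  · intro h l u hlu
    have hbox : (Set.pi univ fun i => Ioo (l i) (u i)) ∈ 𝓝 z :=
      set_pi_mem_nhds finite_univ fun i _ => Ioo_mem_nhds (hlu i).1 (hlu i).2
    obtain ⟨x, hxbox, hxS⟩ := h _ hbox
    exact ⟨x, hxS, fun i => hxbox i (mem_univ i)⟩
  · intro h t ht
    rw [nhds_pi] at ht
    obtain ⟨I, -, s, hs, hIs⟩ := Filter.mem_pi.1 ht
    have hcoord : ∀ i, ∃ l u, z i ∈ Ioo l u ∧ Ioo l u ⊆ s i := fun i =>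
      mem_nhds_iff_exists_Ioo_subset.1 (hs i)
    choose l u hzlu hlus using hcoord
    obtain ⟨x, hxS, hx⟩ := h l u fun i => ⟨(hzlu i).1, (hzlu i).2⟩
    exact ⟨x, hIs fun i _ => hlus i ⟨(hx i).1, (hx i).2⟩, hxS⟩

end Topology

/-! ### Definable families -/

section Definable

variable {K : Type*} {L : FirstOrder.Language.{u, v}} [L.Structure K] {n : ℕ}

/-- **Fibres of a definable family are definable** (with the index as a parameter). [folklore] -/
theorem definable_fibre {Y : K → Set (Fin n → K)}
    (hY : (univ : Set K).Definable L {v : Fin (n + 1) → K | Fin.tail v ∈ Y (v 0)}) (y : K) :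
    (univ : Set K).Definable L (Y y) := by
  have hF : (univ : Set K).DefinableMap L (fun x : Fin n → K => (Fin.cons y x : Fin (n + 1) → K)) := by
    intro i
    refine Fin.cases ?_ (fun j => ?_) i
    · simpa using definableFun_const_params (L := L) (Fin n) (mem_univ y)
    · simpa using definableFun_proj_params (L := L) (A := (univ : Set K)) j
  have h := hY.preimage_map hF
  refine (congrArg _ ?_).mpr h
  ext x
  simp

/-- **A constant family is definable.** [folklore] -/
theorem definable_family_const {S : Set (Fin n → K)} (hS : (univ : Set K).Definable L S) :
    (univ : Set K).Definable L {v : Fin (n + 1) → K | Fin.tail v ∈ (fun _ : K => S) (v 0)} :=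
  hS.preimage_comp Fin.succ

/-- **The first-coordinate relation of a definable family** `Y` in `Kⁿ⁺¹`:
`{(y, t) | ∃ x ∈ Y y, x₀ = t}` is definable. [folklore] -/
theorem definable_firstCoord_rel {Y : K → Set (Fin (n + 1) → K)}
    (hY : (univ : Set K).Definable L {v : Fin (n + 2) → K | Fin.tail v ∈ Y (v 0)}) :
    (univ : Set K).Definable L
      {p : Fin 2 → K | ∃ x' : Fin n → K, (Fin.cons (p 1) x' : Fin (n + 1) → K) ∈ Y (p 0)} := by
  -- the set `{(y, t, x') | cons t x' ∈ Y y}` in the variables `Fin 2 ⊕ Fin n`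
  let φ : Fin (n + 2) → Fin 2 ⊕ Fin n :=
    Fin.cons (Sum.inl 0) (Fin.cons (Sum.inl 1) fun i => Sum.inr i)
  have h₁ := hY.preimage_comp φ
  have h₂ := h₁.exists_of_finite (α := Fin 2) (β := Fin n)
  refine (congrArg _ ?_).mpr h₂
  ext p
  simp only [mem_setOf_eq, mem_preimage]
  refine exists_congr fun x' => ?_
  have hcons : Fin.tail ((Sum.elim p x') ∘ φ) = Fin.cons (p 1) x' := by
    funext j
    refine Fin.cases ?_ (fun i => ?_) j
    · simp [Fin.tail, φ]
    · simp [Fin.tail, φ]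
  have h0 : ((Sum.elim p x') ∘ φ) 0 = p 0 := by simp [φ]
  rw [hcons, h0]

/-- **Images of definable subsets of `Kⁿ⁺¹` under a coordinate function are definable**:
`{x i | x ∈ S}`. [folklore] -/
theorem definable₁_image_eval {S : Set (Fin (n + 1) → K)} (hS : (univ : Set K).Definable L S)
    (i : Fin (n + 1)) : (univ : Set K).Definable₁ L ((fun x => x i) '' S) := by
  have h := hS.image_comp (fun _ : Fin 1 => i)
  rw [Set.Definable₁]
  refine (congrArg _ ?_).mpr h
  ext v
  simp only [mem_setOf_eq, mem_image]
  constructor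
  · rintro ⟨x, hx, hxv⟩
    refine ⟨x, hx, ?_⟩
    funext j
    rw [Subsingleton.elim j 0]
    simpa using hxv
  · rintro ⟨x, hx, rfl⟩
    exact ⟨x, hx, rfl⟩

/-- **Intersecting a definable family with the half-spaces `x₀ ≤ g(y)`** (`g` with definable
graph, `<` definable) gives a definable family. [folklore] -/
theorem definable_family_inter_le [LinearOrder K]
    (hlt : (univ : Set K).Definable L {v : Fin 2 → K | v 0 < v 1})
    {Y : K → Set (Fin (n + 1) → K)}
    (hY : (univ : Set K).Definable L {v : Fin (n + 2) → K | Fin.tail v ∈ Y (v 0)})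
    {g : K → K} (hg : (univ : Set K).Definable L {v : Fin 2 → K | v 1 = g (v 0)}) :
    (univ : Set K).Definable L
      {v : Fin (n + 2) → K | Fin.tail v ∈ (fun y => Y y ∩ {x | x 0 ≤ g y}) (v 0)} := by
  have h₂ : (univ : Set K).Definable L {v : Fin (n + 2) → K | v 1 ≤ g (v 0)} :=
    definable_setOf_le_params hlt (definableFun_proj_params 1)
      (definableFun_apply_params hg (definableFun_proj_params 0))
  have h := hY.inter h₂
  refine (congrArg _ ?_).mpr h
  ext v
  simp [Fin.tail]

/-- **Reversing the index** `y ↦ -y` of a definable family (in an additive group with `+`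
definable) gives a definable family. [folklore] -/
theorem definable_family_neg_index [AddGroup K]
    (hadd : (univ : Set K).Definable L {v : Fin 3 → K | v 2 = v 0 + v 1})
    {Y : K → Set (Fin n → K)}
    (hY : (univ : Set K).Definable L {v : Fin (n + 1) → K | Fin.tail v ∈ Y (v 0)}) :
    (univ : Set K).Definable L {v : Fin (n + 1) → K | Fin.tail v ∈ (fun s => Y (-s)) (v 0)} := by
  -- the graph of negation from that of addition: `z = -y ↔ y + z = 0`
  have hneg : (univ : Set K).Definable L {v : Fin 2 → K | v 1 = -v 0} := by
    have h0 : (univ : Set K).Definable L {v : Fin 2 → K | v 0 + v 1 = 0} := by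
      have hsum : (univ : Set K).DefinableFun L (fun v : Fin 2 → K => v 0 + v 1) :=
        definableFun_apply₂_params hadd (definableFun_proj_params 0) (definableFun_proj_params 1)
      exact definable_setOf_eq_params hsum (definableFun_const_params _ (mem_univ (0 : K)))
    refine (congrArg _ ?_).mpr h0
    ext v
    simp only [mem_setOf_eq]
    constructor
    · intro h; rw [h, add_neg_cancel]
    · intro h; exact (neg_eq_of_add_eq_zero_right h).symm
  have hF : (univ : Set K).DefinableMap L
      (fun v : Fin (n + 1) → K => (Fin.cons (-v 0) (Fin.tail v) : Fin (n + 1) → K)) := by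
    intro i
    refine Fin.cases ?_ (fun j => ?_) i
    · simpa using definableFun_apply_params hneg (definableFun_proj_params (L := L)
        (A := (univ : Set K)) (0 : Fin (n + 1)))
    · simpa [Fin.tail] using definableFun_proj_params (L := L) (A := (univ : Set K)) j.succ
  have h := hY.preimage_map hF
  refine (congrArg _ ?_).mpr h
  ext v
  simp

/-- **Projecting a definable family along the first coordinate of the point**:
`y ↦ {x' | ∃ t, (t, x') ∈ Y y} = Fin.tail '' (Y y)` is a definable family. [folklore] -/
theorem definable_family_tail_image {Y : K → Set (Fin (n + 1) → K)}
    (hY : (univ : Set K).Definable L {v : Fin (n + 2) → K | Fin.tail v ∈ Y (v 0)}) :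
    (univ : Set K).Definable L
      {w : Fin (n + 1) → K | Fin.tail w ∈ (fun y => Fin.tail '' (Y y)) (w 0)} := by
  -- `{(y, x', t) | cons t x' ∈ Y y}` in the variables `Fin (n + 1) ⊕ Fin 1`, then `∃ t`
  let φ : Fin (n + 2) → Fin (n + 1) ⊕ Fin 1 :=
    Fin.cons (Sum.inl 0) (Fin.cons (Sum.inr 0) fun i => Sum.inl i.succ)
  have h₁ := hY.preimage_comp φ
  have h₂ := h₁.exists_of_finite (α := Fin (n + 1)) (β := Fin 1)
  refine (congrArg _ ?_).mpr h₂
  ext w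
  simp only [mem_setOf_eq, mem_preimage, mem_image]
  constructor
  · rintro ⟨x, hx, hxw⟩
    refine ⟨fun _ => x 0, ?_⟩
    have hcomp : Fin.tail ((Sum.elim w fun _ => x 0) ∘ φ) = x := by
      funext j
      refine Fin.cases ?_ (fun i => ?_) j
      · simp [Fin.tail, φ]
      · have := congrFun hxw i
        simp only [Fin.tail] at this
        simp [Fin.tail, φ, this]
    have h0 : ((Sum.elim w fun _ => x 0) ∘ φ) 0 = w 0 := by simp [φ]
    rw [hcomp, h0]
    exact hx
  · rintro ⟨t, ht⟩
    refine ⟨Fin.tail ((Sum.elim w t) ∘ φ), ?_, ?_⟩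
    · have h0 : ((Sum.elim w t) ∘ φ) 0 = w 0 := by simp [φ]
      rw [h0] at ht
      exact ht
    · funext i
      simp [Fin.tail, φ]

variable [LinearOrder K] [TopologicalSpace K] [OrderTopology K] [NoMinOrder K] [NoMaxOrder K]

/-- **The closures of a definable family form a definable family** (`<` definable; the closure
is expressed through open boxes, `mem_closure_iff_forall_box`). [folklore] -/
theorem definable_family_closure
    (hlt : (univ : Set K).Definable L {v : Fin 2 → K | v 0 < v 1})
    {W : K → Set (Fin n → K)}
    (hW : (univ : Set K).Definable L {v : Fin (n + 1) → K | Fin.tail v ∈ W (v 0)}) :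
    (univ : Set K).Definable L
      {v : Fin (n + 1) → K | Fin.tail v ∈ (fun y => closure (W y)) (v 0)} := by
  -- variables: `v : Fin (n+1)`, then the box `lu : Fin n ⊕ Fin n`, then the witness `x' : Fin n`
  -- (1) `{(v, lu, x') | x' ∈ W (v 0) ∧ x' ∈ box lu}`
  let φ : Fin (n + 1) → (Fin (n + 1) ⊕ (Fin n ⊕ Fin n)) ⊕ Fin n :=
    Fin.cons (Sum.inl (Sum.inl 0)) fun i => Sum.inr i
  have hT₁ := hW.preimage_comp φ
  have hT₂ : (univ : Set K).Definable L
      {z : (Fin (n + 1) ⊕ (Fin n ⊕ Fin n)) ⊕ Fin n → K |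
        ∀ i : Fin n, z (Sum.inl (Sum.inr (Sum.inl i))) < z (Sum.inr i) ∧
          z (Sum.inr i) < z (Sum.inl (Sum.inr (Sum.inr i)))} := by
    have h := definable_iInter_of_finite (L := L) (A := (univ : Set K)) fun i : Fin n =>
      (definable_setOf_lt_params hlt
        (definableFun_proj_params (α := (Fin (n + 1) ⊕ (Fin n ⊕ Fin n)) ⊕ Fin n)
          (Sum.inl (Sum.inr (Sum.inl i))))
        (definableFun_proj_params (Sum.inr i))).inter
      (definable_setOf_lt_params hlt
        (definableFun_proj_params (α := (Fin (n + 1) ⊕ (Fin n ⊕ Fin n)) ⊕ Fin n) (Sum.inr i))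
        (definableFun_proj_params (Sum.inl (Sum.inr (Sum.inr i)))))
    refine (congrArg _ ?_).mpr h
    ext z
    simp only [mem_setOf_eq, mem_iInter, mem_inter_iff]
  have hT := hT₁.inter hT₂
  -- (2) `∃ x'`
  have hE := hT.exists_of_finite (α := Fin (n + 1) ⊕ (Fin n ⊕ Fin n)) (β := Fin n)
  -- (3) the box around `tail v`
  have hB : (univ : Set K).Definable L
      {w : Fin (n + 1) ⊕ (Fin n ⊕ Fin n) → K |
        ∀ i : Fin n, w (Sum.inr (Sum.inl i)) < w (Sum.inl i.succ) ∧
          w (Sum.inl i.succ) < w (Sum.inr (Sum.inr i))} := by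
    have h := definable_iInter_of_finite (L := L) (A := (univ : Set K)) fun i : Fin n =>
      (definable_setOf_lt_params hlt
        (definableFun_proj_params (Sum.inr (Sum.inl i))) (definableFun_proj_params (Sum.inl i.succ))).inter
      (definable_setOf_lt_params hlt
        (definableFun_proj_params (Sum.inl i.succ)) (definableFun_proj_params (Sum.inr (Sum.inr i))))
    refine (congrArg _ ?_).mpr h
    ext w
    simp only [mem_setOf_eq, mem_iInter, mem_inter_iff]
  -- (4) implication and `∀ lu`
  have hImp := hB.compl.union hE
  have hA := hImp.forall_of_finite (α := Fin (n + 1)) (β := Fin n ⊕ Fin n)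
  refine (congrArg _ ?_).mpr hA
  ext v
  simp only [mem_setOf_eq, mem_union, mem_compl_iff, mem_preimage, mem_inter_iff,
    Sum.elim_inl, Sum.elim_inr]
  rw [mem_closure_iff_forall_box]
  constructor
  · intro h lu
    by_cases hbox : ∀ i : Fin n, lu (Sum.inl i) < v i.succ ∧ v i.succ < lu (Sum.inr i)
    · right
      obtain ⟨x, hxW, hx⟩ := h (fun i => lu (Sum.inl i)) (fun i => lu (Sum.inr i)) hbox
      refine ⟨x, ?_, fun i => hx i⟩
      have hcomp : Fin.tail ((Sum.elim (Sum.elim v lu) x) ∘ φ) = x := by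
        funext j; simp [Fin.tail, φ]
      have h0 : ((Sum.elim (Sum.elim v lu) x) ∘ φ) 0 = v 0 := by simp [φ]
      rw [hcomp, h0]
      exact hxW
    · left
      exact hbox
  · intro h l u hlu
    rcases h (Sum.elim l u) with hbox | ⟨x, hxW, hx⟩
    · exact absurd (fun i => hlu i) hbox
    · refine ⟨x, ?_, fun i => hx i⟩
      have hcomp : Fin.tail ((Sum.elim (Sum.elim v (Sum.elim l u)) x) ∘ φ) = x := by
        funext j; simp [Fin.tail, φ]
      have h0 : ((Sum.elim (Sum.elim v (Sum.elim l u)) x) ∘ φ) 0 = v 0 := by simp [φ]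
      rw [hcomp, h0] at hxW
      exact hxW

end Definable

end Literature.ModelTheory.ExponentialFields
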